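import Literature.NumberTheory.LFunctions.PolynomialRootMoebiusSharpCutoff
import Literature.NumberTheory.LFunctions.PolynomialRootChebyshev
import Literature.NumberTheory.Sieve.FriableMoebiusRootSumIdentity
import Mathlib.Analysis.SpecialFunctions.Integrals.Basic
import Literature.NumberTheory.Transcendental.MahlerManinEndgame
import HarnessLib

/-!
# The friable Möbius–root sum in the base range `y ≤ x ≤ y²`: bookkeeping lemmas

Topic `Literature/NumberTheory/Sieve` (inputs of `FriableMoebiusRootSumBase.lean`). Everything here
is PROVED; no definitions, no named facts. For `g ∈ ℤ[X]` irreducible of positive degree write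
`ρ = ρ_g` (`polyRootCountMod ![g]`), `w(n) = μ(n)ρ(n)/n`, `M(V) = ∑_{n ≤ V} w(n)`.

* `exists_abs_partialSum_le` — `|M(V)| ≤ B` for all `V` (Landau's `M(x) ≪ 1/log² x`, tree
  `abs_sum_moebius_rootCount_div_le`);
* `abs_sum_range_primeWeight_sub_le` — the Chebyshev input in the form consumed by
  `HyperbolaAbel.abs_sum_weight_mul_sub_sum_le_sharp`: with `c(k) = ρ(k) log k` at primes, `0` elsewhere,
  `|∑_{i ≤ k} (c(i) − 1)| ≤ (C₀ + 4) k/log² k` (`k ≥ 2`);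
* `abs_friableSum_div_sub_sum_Icc_le` — `|G(⌊X/p⌋, p) − M(⌊X/p⌋)| ≤ ρ(p)/p` for `X ≤ p²`
  (the only non-`p`-friable `d ≤ X/p ≤ p` is `d = p`);
* `sum_Ico_prime_sq_div_sq_le` — `∑_{N ≤ p ≤ X} ρ(p)²/p² ≤ (deg g)²/(N − 1)`;
* `integral_exp_neg_sqrt_log_div_le` — `∫_1^V C e^{−c√log t} dt/t ≤ C (1 + 24/c⁴)`;
* `abs_moebius_eq_sq` (`|μ(n)| = μ(n)²`), `loglog_add_one_sub_loglog_le`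
  (`log log(t+1) − log log t ≤ 1/(t log t)`).

## References

* E. Landau, Math. Ann. 56 (1903), 645–670. [LandauMathAnn1903]
* G. Tenenbaum, *Introduction to analytic and probabilistic number theory*, Ch. III.6. [Tenenbaum2015]
-/

open Finset Real MeasureTheory Set intervalIntegral Polynomial

noncomputable section

namespace Literature.NumberTheory.Sieve

namespace FriableMoebiusRoot

open Literature.NumberTheory.LFunctions

/-! ### `|M(V)| ≤ B` -/

/-- **Uniform bound for the partial sums `M(V) = ∑_{n ≤ V} μ(n)ρ_g(n)/n`**: there is `B ≥ 1` with
`|M(V)| ≤ B` for every `V` (`M(V) ≪ 1/log² V`, and `M(0) = 0`, `M(1) = 1`).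
[cite: LandauMathAnn1903, Part II] -/
theorem exists_abs_partialSum_le {g : ℤ[X]} (hirr : Irreducible g) (hdeg : 0 < g.natDegree) :
    ∃ B : ℝ, 1 ≤ B ∧ ∀ V : ℕ,
      |∑ n ∈ Icc 1 V, (ArithmeticFunction.moebius n : ℝ) * (polyRootCountMod ![g] n : ℝ) / n| ≤ B := by
  obtain ⟨C, hC⟩ := abs_sum_moebius_rootCount_div_le hirr hdeg
  have hl2 : 0 < Real.log 2 := Real.log_pos one_lt_two
  have hC0 : 0 ≤ C := by
    have h := (abs_nonneg _).trans (hC 2 le_rfl)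
    rw [le_div_iff₀ (pow_pos hl2 2), zero_mul] at h
    exact h
  refine ⟨max 1 (C / Real.log 2 ^ 2), le_max_left _ _, fun V => ?_⟩
  rcases Nat.lt_or_ge V 2 with hV | hV
  · interval_cases V
    · simp
    · rw [Finset.Icc_self, sum_singleton, ArithmeticFunction.moebius_apply_one,
        polyRootCountMod_single_one]
      simp
  · have hV' : (2 : ℝ) ≤ V := by exact_mod_cast hV
    have h := hC V hV'
    rw [Nat.floor_natCast] at h
    refine h.trans ((div_le_div_of_nonneg_left hC0 (pow_pos hl2 2)
      (pow_le_pow_left₀ hl2.le (Real.log_le_log two_pos hV') 2)).trans (le_max_right _ _))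

/-! ### The Chebyshev input -/

/-- **The Chebyshev input for `HyperbolaAbel.abs_sum_weight_mul_sub_sum_le_sharp`.** If
`|∑_{p ≤ t} ρ(p) log p − t| ≤ C₀ t/log² t` for `t ≥ 2`, then with `c(k) = ρ(k) log k` at primes and
`0` elsewhere, `|∑_{i ≤ k} (c(i) − 1)| ≤ (C₀ + 4) k/log² k` for all `k ≥ 2`
(`∑_{i ≤ k} c(i) = ∑_{p ≤ k} ρ(p) log p`, `∑_{i ≤ k} 1 = k + 1`, `1 ≤ 4k/log² k`). [folklore] -/
theorem abs_sum_range_primeWeight_sub_le {ρ : ℕ → ℝ} {C₀ : ℝ}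
    (hθ : ∀ t : ℝ, 2 ≤ t → |∑ p ∈ Nat.primesLE ⌊t⌋₊, ρ p * Real.log p - t| ≤ C₀ * t / Real.log t ^ 2)
    {k : ℕ} (hk : 2 ≤ k) :
    |∑ i ∈ range (k + 1), ((if i.Prime then ρ i * Real.log i else 0) - 1)| ≤
      (C₀ + 4) * k / Real.log k ^ 2 := by
  have hk' : (2 : ℝ) ≤ k := by exact_mod_cast hk
  have hlk : 0 < Real.log k := Real.log_pos (by linarith)
  have hsum : ∑ i ∈ range (k + 1), (if i.Prime then ρ i * Real.log i else 0) =
      ∑ p ∈ Nat.primesLE ⌊(k : ℝ)⌋₊, ρ p * Real.log p := by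
    rw [Nat.floor_natCast, Nat.primesLE, Nat.primesBelow, Finset.sum_filter]
  rw [Finset.sum_sub_distrib, hsum, Finset.sum_const, Finset.card_range, nsmul_eq_mul, mul_one]
  have h := hθ k hk'
  have h4 : (1 : ℝ) ≤ 4 * k / Real.log k ^ 2 := by
    rw [le_div_iff₀ (pow_pos hlk 2), one_mul]
    exact Literature.NumberTheory.Transcendental.log_sq_le_four_mul (by linarith)
  push_cast
  calc |∑ p ∈ Nat.primesLE ⌊(k : ℝ)⌋₊, ρ p * Real.log p - (k + 1)|
      = |(∑ p ∈ Nat.primesLE ⌊(k : ℝ)⌋₊, ρ p * Real.log p - k) - 1| := by ring_nf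
    _ ≤ |∑ p ∈ Nat.primesLE ⌊(k : ℝ)⌋₊, ρ p * Real.log p - k| + |(1 : ℝ)| := abs_sub _ _
    _ ≤ C₀ * k / Real.log k ^ 2 + 4 * k / Real.log k ^ 2 := by rw [abs_one]; exact add_le_add h h4
    _ = (C₀ + 4) * k / Real.log k ^ 2 := by ring

/-! ### The complete inner sums near the diagonal `p² = X` -/

/-- **`|G_g(⌊X/p⌋, p) − M_g(⌊X/p⌋)| ≤ ρ_g(p)/p` for a prime `p` with `X ≤ p²`**: the only possibly
non-`p`-friable `d ≤ X/p ≤ p` is `d = p` (and the two sums agree when `X < p²`). [folklore] -/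
theorem abs_friableSum_div_sub_sum_Icc_le (g : ℤ[X]) {X p : ℕ} (hp : p.Prime) (hX : X ≤ p * p) :
    |(∑ d ∈ Nat.smoothNumbersUpTo (X / p) p,
        (ArithmeticFunction.moebius d : ℝ) * (polyRootCountMod ![g] d : ℝ) / d) -
      ∑ d ∈ Icc 1 (X / p), (ArithmeticFunction.moebius d : ℝ) * (polyRootCountMod ![g] d : ℝ) / d| ≤
      (polyRootCountMod ![g] p : ℝ) / p := by
  have hp0 : 0 < p := hp.pos
  have hρ0 : 0 ≤ (polyRootCountMod ![g] p : ℝ) / p := by positivity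
  rcases Nat.lt_or_ge X (p * p) with hlt | hge
  · rw [friableSum_div_eq_sum_Icc_of_sq_lt g hp0 hlt, sub_self, abs_zero]
    exact hρ0
  · have hXp : X = p * p := le_antisymm hX hge
    have hdiv : X / p = p := by rw [hXp, Nat.mul_div_cancel _ hp0]
    rw [hdiv]
    -- `smoothNumbersUpTo p p = smoothNumbersUpTo (p - 1) p` and `Icc 1 p = Icc 1 (p-1) ∪ {p}`
    have hp1 : p - 1 < p := Nat.sub_lt hp0 one_pos
    have hset : Nat.smoothNumbersUpTo p p = Nat.smoothNumbersUpTo (p - 1) p := by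
      ext n
      simp only [Nat.mem_smoothNumbersUpTo]
      constructor
      · rintro ⟨hn, hs⟩
        refine ⟨?_, hs⟩
        rcases Nat.lt_or_ge n p with h | h
        · omega
        · exfalso
          have hnp : n = p := le_antisymm hn h
          subst hnp
          have := (Nat.mem_smoothNumbers.mp hs).2 n ((Nat.mem_primeFactorsList hp.ne_zero).mpr ⟨hp, dvd_rfl⟩)
          exact lt_irrefl _ this
      · rintro ⟨hn, hs⟩
        exact ⟨by omega, hs⟩
    have hIcc : Finset.Icc 1 p = Finset.Icc 1 (p - 1) ∪ {p} := by
      ext n; simp only [Finset.mem_union, Finset.mem_Icc, Finset.mem_singleton]; omega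
    have hdisj : Disjoint (Finset.Icc 1 (p - 1)) {p} := by
      rw [Finset.disjoint_singleton_right, Finset.mem_Icc]; omega
    rw [hset, friableSum_eq_sum_Icc_of_lt g hp1, hIcc, Finset.sum_union hdisj, sum_singleton]
    rw [ArithmeticFunction.moebius_apply_prime hp]
    push_cast
    rw [show ∀ a b : ℝ, a - (a + b) = -b from fun a b => by ring, abs_neg, abs_div,
      abs_of_pos (by exact_mod_cast hp0 : (0:ℝ) < p)]
    refine div_le_div_of_nonneg_right (le_of_eq ?_) (by positivity)
    rw [abs_mul, abs_neg, abs_one, one_mul, abs_of_nonneg (Nat.cast_nonneg _)]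

/-- Telescoping over `Ico N X`: `∑_{N ≤ k < X} (f (k+1) − f k) = f X − f N`. [folklore] -/
private theorem sum_Ico_succ_sub'' (f : ℕ → ℝ) {N X : ℕ} (h : N ≤ X) :
    ∑ k ∈ Finset.Ico N X, (f (k + 1) - f k) = f X - f N := by
  induction X, h using Nat.le_induction with
  | base => simp
  | succ X hNX ih => rw [Finset.sum_Ico_succ_top hNX, ih]; ring

/-- **`∑_{N ≤ p ≤ X, p prime} (ρ_g(p)/p)² ≤ (deg g)²/(N − 1)`** for `N ≥ 2` (`ρ_g(p) ≤ deg g` and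
`∑_{n ≥ N} 1/n² ≤ ∑_{n ≥ N} (1/(n−1) − 1/n) = 1/(N − 1)`). [folklore] -/
theorem sum_Ico_prime_sq_div_sq_le {g : ℤ[X]} (hirr : Irreducible g) (hdeg : 0 < g.natDegree)
    {N : ℕ} (hN : 2 ≤ N) (X : ℕ) :
    ∑ p ∈ (Finset.Ico N (X + 1)).filter Nat.Prime,
        (polyRootCountMod ![g] p : ℝ) / p * ((polyRootCountMod ![g] p : ℝ) / p) ≤
      (g.natDegree : ℝ) ^ 2 / (N - 1) := by
  set d : ℝ := (g.natDegree : ℝ) with hd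
  have hN' : (2 : ℝ) ≤ N := by exact_mod_cast hN
  rcases Nat.lt_or_ge X N with hXN | hXN
  · have : (Finset.Ico N (X + 1)).filter Nat.Prime = ∅ := by
      rw [Finset.filter_eq_empty_iff]; intro p hp; simp only [Finset.mem_Ico] at hp; omega
    rw [this, sum_empty]
    exact div_nonneg (by positivity) (by linarith)
  -- termwise `(ρ(p)/p)² ≤ d² (1/(p−1) − 1/p)`
  have hterm : ∀ p ∈ (Finset.Ico N (X + 1)).filter Nat.Prime,
      (polyRootCountMod ![g] p : ℝ) / p * ((polyRootCountMod ![g] p : ℝ) / p) ≤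
        d ^ 2 * (1 / ((p : ℝ) - 1) - 1 / p) := by
    intro p hp
    obtain ⟨hpI, hpp⟩ := Finset.mem_filter.mp hp
    have hp2 : (2 : ℝ) ≤ p := by exact_mod_cast hpp.two_le
    have hρ : (polyRootCountMod ![g] p : ℝ) ≤ d := by
      rw [hd]; exact_mod_cast polyRootCountMod_prime_le_natDegree_of_irreducible hirr hdeg hpp
    have hρ0 : 0 ≤ (polyRootCountMod ![g] p : ℝ) := Nat.cast_nonneg _
    have h1 : (polyRootCountMod ![g] p : ℝ) / p * ((polyRootCountMod ![g] p : ℝ) / p) ≤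
        d / p * (d / p) :=
      mul_le_mul (div_le_div_of_nonneg_right hρ (by linarith)) (div_le_div_of_nonneg_right hρ (by linarith))
        (by positivity) (by positivity)
    have h2 : d / p * (d / p) = d ^ 2 * (1 / ((p : ℝ) * p)) := by field_simp
    have h3 : 1 / ((p : ℝ) * p) ≤ 1 / ((p : ℝ) - 1) - 1 / p := by
      rw [div_sub_div _ _ (by linarith) (by linarith), div_le_div_iff₀ (by positivity) (by nlinarith)]
      nlinarith
    calc _ ≤ d / p * (d / p) := h1
      _ = d ^ 2 * (1 / ((p : ℝ) * p)) := h2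
      _ ≤ d ^ 2 * (1 / ((p : ℝ) - 1) - 1 / p) := mul_le_mul_of_nonneg_left h3 (by positivity)
  have hnonneg : ∀ n ∈ Finset.Ico N (X + 1), 0 ≤ d ^ 2 * (1 / ((n : ℝ) - 1) - 1 / n) := by
    intro n hn
    have hn2 : (2 : ℝ) ≤ n := by exact_mod_cast le_trans hN (Finset.mem_Ico.mp hn).1
    refine mul_nonneg (by positivity) (sub_nonneg.mpr ?_)
    exact one_div_le_one_div_of_le (by linarith) (by linarith)
  calc ∑ p ∈ (Finset.Ico N (X + 1)).filter Nat.Prime,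
        (polyRootCountMod ![g] p : ℝ) / p * ((polyRootCountMod ![g] p : ℝ) / p)
      ≤ ∑ p ∈ (Finset.Ico N (X + 1)).filter Nat.Prime, d ^ 2 * (1 / ((p : ℝ) - 1) - 1 / p) :=
        Finset.sum_le_sum hterm
    _ ≤ ∑ n ∈ Finset.Ico N (X + 1), d ^ 2 * (1 / ((n : ℝ) - 1) - 1 / n) :=
        Finset.sum_le_sum_of_subset_of_nonneg (Finset.filter_subset _ _) fun n hn _ => hnonneg n hn
    _ = d ^ 2 * (1 / ((N : ℝ) - 1) - 1 / (X : ℝ)) := by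
        rw [← Finset.mul_sum]
        congr 1
        have h := sum_Ico_succ_sub'' (fun k : ℕ => -(1 / ((k : ℝ) - 1))) (by omega : N ≤ X + 1)
        have h' : ∀ k : ℕ, k ∈ Finset.Ico N (X + 1) →
            (-(1 / (((k + 1 : ℕ) : ℝ) - 1)) - -(1 / ((k : ℝ) - 1))) = 1 / ((k : ℝ) - 1) - 1 / k := by
          intro k _
          push_cast
          ring
        rw [Finset.sum_congr rfl h'] at h
        rw [h]
        push_cast
        ring
    _ ≤ d ^ 2 * (1 / ((N : ℝ) - 1)) := by
        refine mul_le_mul_of_nonneg_left ?_ (by positivity)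
        have : 0 ≤ 1 / (X : ℝ) := by positivity
        linarith
    _ = d ^ 2 / (N - 1) := by ring

/-! ### Two elementary facts -/

/-- `|μ(n)| = μ(n)²` (as real numbers). [folklore] -/
theorem abs_moebius_eq_sq (n : ℕ) :
    |(ArithmeticFunction.moebius n : ℝ)| = (ArithmeticFunction.moebius n : ℝ) ^ 2 := by
  have h := ArithmeticFunction.abs_moebius_le_one (n := n)
  rw [abs_le] at h
  rcases (show ArithmeticFunction.moebius n = -1 ∨ ArithmeticFunction.moebius n = 0 ∨
    ArithmeticFunction.moebius n = 1 by omega) with h1 | h1 | h1 <;> simp [h1]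

/-- The real-variable form of `log log (t + 1) − log log t ≤ 1/(t log t)` (`t > 1`). [folklore] -/
theorem loglog_add_one_sub_loglog_le {t : ℝ} (ht : 1 < t) :
    Real.log (Real.log (t + 1)) - Real.log (Real.log t) ≤ 1 / (t * Real.log t) := by
  have h0 : 0 < t := by linarith
  have hlt : 0 < Real.log t := Real.log_pos ht
  have hlt1 : 0 < Real.log (t + 1) := Real.log_pos (by linarith)
  have h1 : Real.log (t + 1) - Real.log t ≤ 1 / t := by
    rw [← Real.log_div (by linarith) h0.ne']
    have := Real.log_le_sub_one_of_pos (show 0 < (t + 1) / t by positivity)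
    rw [show (t + 1) / t - 1 = 1 / t by field_simp; ring] at this
    exact this
  rw [← Real.log_div hlt1.ne' hlt.ne']
  calc Real.log (Real.log (t + 1) / Real.log t) ≤ Real.log (t + 1) / Real.log t - 1 :=
        Real.log_le_sub_one_of_pos (div_pos hlt1 hlt)
    _ = (Real.log (t + 1) - Real.log t) / Real.log t := by field_simp
    _ ≤ (1 / t) / Real.log t := div_le_div_of_nonneg_right h1 hlt.le
    _ = 1 / (t * Real.log t) := by rw [div_div]

/-! ### The boundary-layer integral -/

/-- `e^{−c√s} ≤ 24/(c⁴ s²)` for `c, s > 0` (`(c√s)⁴/4! ≤ e^{c√s}`). [folklore] -/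
theorem exp_neg_mul_sqrt_le {c s : ℝ} (hc : 0 < c) (hs : 0 < s) :
    Real.exp (-c * Real.sqrt s) ≤ 24 / (c ^ 4 * s ^ 2) := by
  have hu : 0 ≤ c * Real.sqrt s := by positivity
  have h := Real.pow_div_factorial_le_exp (c * Real.sqrt s) hu 4
  have h4 : (Nat.factorial 4 : ℝ) = 24 := by norm_num [Nat.factorial]
  rw [h4, mul_pow, show Real.sqrt s ^ 4 = s ^ 2 by
    rw [show (4:ℕ) = 2 * 2 from rfl, pow_mul, Real.sq_sqrt hs.le]] at h
  have hpos : 0 < c ^ 4 * s ^ 2 := by positivity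
  rw [neg_mul, Real.exp_neg, inv_eq_one_div, div_le_div_iff₀ (Real.exp_pos _) hpos, one_mul]
  rw [div_le_iff₀ (by norm_num : (0:ℝ) < 24)] at h
  linarith

/-- **`∫_1^V C e^{−c√(log t)} dt/t ≤ C (1 + 24/c⁴)`** for `c > 0`, `C ≥ 0`, `V ≥ 1`
(`≤ C ∫_1^e dt/t + (24C/c⁴) ∫_e^V dt/(t log² t)`). [folklore] -/
theorem integral_exp_neg_sqrt_log_div_le {c C V : ℝ} (hc : 0 < c) (hC : 0 ≤ C) (hV : 1 ≤ V) :
    ∫ t in (1:ℝ)..V, C * Real.exp (-c * Real.sqrt (Real.log t)) / t ≤ C * (1 + 24 / c ^ 4) := by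
  set f : ℝ → ℝ := fun t => C * Real.exp (-c * Real.sqrt (Real.log t)) / t with hf
  have hfc : ContinuousOn f (Set.Ici 1) := by
    have hlog : ContinuousOn Real.log (Set.Ici (1:ℝ)) :=
      Real.continuousOn_log.mono fun t ht => ne_of_gt (lt_of_lt_of_le one_pos ht)
    refine ContinuousOn.div (continuousOn_const.mul ?_) continuousOn_id fun t ht =>
      ne_of_gt (lt_of_lt_of_le one_pos ht)
    exact (Real.continuous_exp.comp_continuousOn ((continuousOn_const.mul
      (Real.continuous_sqrt.comp_continuousOn hlog))))
  have hfi : ∀ a b : ℝ, 1 ≤ a → a ≤ b → IntervalIntegrable f volume a b := fun a b ha hab =>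
    (hfc.mono (fun t ht => Set.mem_Ici.mpr (ha.trans ht.1))).intervalIntegrable_of_Icc hab
  -- pointwise bounds
  have hf1 : ∀ t : ℝ, 1 ≤ t → f t ≤ C / t := by
    intro t ht
    have ht0 : 0 < t := by linarith
    simp only [hf]
    refine div_le_div_of_nonneg_right ?_ ht0.le
    calc C * Real.exp (-c * Real.sqrt (Real.log t)) ≤ C * 1 := by
          refine mul_le_mul_of_nonneg_left ?_ hC
          rw [Real.exp_le_one_iff]
          have := Real.sqrt_nonneg (Real.log t)
          nlinarith
      _ = C := mul_one C
  have hf2 : ∀ t : ℝ, Real.exp 1 ≤ t → f t ≤ 24 * C / c ^ 4 * (t⁻¹ / Real.log t ^ 2) := by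
    intro t ht
    have ht0 : 0 < t := (Real.exp_pos 1).trans_le ht
    have hlt : 1 ≤ Real.log t := by rwa [Real.le_log_iff_exp_le ht0]
    have hb := exp_neg_mul_sqrt_le hc (by linarith : 0 < Real.log t)
    simp only [hf]
    rw [div_eq_mul_inv]
    calc C * Real.exp (-c * Real.sqrt (Real.log t)) * t⁻¹ ≤ C * (24 / (c ^ 4 * Real.log t ^ 2)) * t⁻¹ :=
          mul_le_mul_of_nonneg_right (mul_le_mul_of_nonneg_left hb hC) (by positivity)
      _ = 24 * C / c ^ 4 * (t⁻¹ / Real.log t ^ 2) := by field_simp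
  -- `∫_1^b C/t = C log b ≤ C` for `b ≤ e`
  have hI1 : ∀ b : ℝ, 1 ≤ b → b ≤ Real.exp 1 → ∫ t in (1:ℝ)..b, f t ≤ C := by
    intro b hb hbe
    have hb0 : 0 < b := by linarith
    calc ∫ t in (1:ℝ)..b, f t ≤ ∫ t in (1:ℝ)..b, C / t := by
          refine intervalIntegral.integral_mono_on hb (hfi 1 b le_rfl hb) ?_ fun t ht => hf1 t ht.1
          exact (continuousOn_const.div continuousOn_id fun t ht =>
            ne_of_gt (lt_of_lt_of_le one_pos ht.1)).intervalIntegrable_of_Icc hb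
      _ = C * Real.log b := by
          rw [show (fun t : ℝ => C / t) = fun t => C * t⁻¹ from funext fun t => div_eq_mul_inv C t,
            intervalIntegral.integral_const_mul, integral_inv_of_pos one_pos hb0, div_one]
      _ ≤ C * 1 := by
          refine mul_le_mul_of_nonneg_left ?_ hC
          rw [Real.log_le_iff_le_exp hb0]; exact hbe
      _ = C := mul_one C
  rcases le_or_gt V (Real.exp 1) with hVe | hVe
  · calc ∫ t in (1:ℝ)..V, f t ≤ C := hI1 V hV hVe
      _ ≤ C * (1 + 24 / c ^ 4) := by
          have : 0 ≤ C * (24 / c ^ 4) := by positivity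
          nlinarith
  · have he1 : (1:ℝ) ≤ Real.exp 1 := by have := Real.add_one_le_exp (1:ℝ); linarith
    rw [← intervalIntegral.integral_add_adjacent_intervals (hfi 1 _ le_rfl he1) (hfi _ V he1 hVe.le)]
    -- `∫_e^V dt/(t log² t) = 1 − 1/log V ≤ 1`
    have hV0 : 0 < V := by linarith
    have hFTC : ∫ t in Real.exp 1..V, t⁻¹ / Real.log t ^ 2 = 1 / Real.log (Real.exp 1) - 1 / Real.log V := by
      have huIcc : Set.uIcc (Real.exp 1) V = Set.Icc (Real.exp 1) V := Set.uIcc_of_le hVe.le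
      have hderiv : ∀ t ∈ Set.uIcc (Real.exp 1) V,
          HasDerivAt (fun s => -(Real.log s)⁻¹) (t⁻¹ / Real.log t ^ 2) t := by
        intro t ht
        rw [huIcc] at ht
        have ht0 : 0 < t := (Real.exp_pos 1).trans_le ht.1
        have hlt : 0 < Real.log t := by
          have : 1 ≤ Real.log t := by rw [Real.le_log_iff_exp_le ht0]; exact ht.1
          linarith
        have h := ((Real.hasDerivAt_log ht0.ne').inv hlt.ne').neg
        exact h.congr_deriv (by field_simp)
      have hcont : ContinuousOn (fun t : ℝ => t⁻¹ / Real.log t ^ 2) (Set.Icc (Real.exp 1) V) := by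
        have h0 : ∀ t ∈ Set.Icc (Real.exp 1) V, 0 < t := fun t ht => (Real.exp_pos 1).trans_le ht.1
        refine ContinuousOn.div (continuousOn_inv₀.mono fun t ht => (h0 t ht).ne') ?_ fun t ht => ?_
        · exact (Real.continuousOn_log.mono fun t ht => (h0 t ht).ne').pow 2
        · have : 1 ≤ Real.log t := by rw [Real.le_log_iff_exp_le (h0 t ht)]; exact ht.1
          positivity
      rw [intervalIntegral.integral_eq_sub_of_hasDerivAt hderiv (hcont.intervalIntegrable_of_Icc hVe.le)]
      simp only [one_div]
      ring
    rw [Real.log_exp] at hFTC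
    have hlV : 0 < Real.log V := Real.log_pos (by linarith)
    have hI2 : ∫ t in Real.exp 1..V, f t ≤ 24 * C / c ^ 4 := by
      calc ∫ t in Real.exp 1..V, f t ≤ ∫ t in Real.exp 1..V, 24 * C / c ^ 4 * (t⁻¹ / Real.log t ^ 2) := by
            refine intervalIntegral.integral_mono_on hVe.le (hfi _ V he1 hVe.le) ?_ fun t ht => hf2 t ht.1
            refine ((continuousOn_const.mul ?_)).intervalIntegrable_of_Icc hVe.le
            have h0 : ∀ t ∈ Set.Icc (Real.exp 1) V, 0 < t := fun t ht => (Real.exp_pos 1).trans_le ht.1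
            refine ContinuousOn.div (continuousOn_inv₀.mono fun t ht => (h0 t ht).ne') ?_ fun t ht => ?_
            · exact (Real.continuousOn_log.mono fun t ht => (h0 t ht).ne').pow 2
            · have : 1 ≤ Real.log t := by rw [Real.le_log_iff_exp_le (h0 t ht)]; exact ht.1
              positivity
        _ = 24 * C / c ^ 4 * (1 / 1 - 1 / Real.log V) := by
            rw [intervalIntegral.integral_const_mul, hFTC]
        _ ≤ 24 * C / c ^ 4 * 1 := by
            refine mul_le_mul_of_nonneg_left ?_ (by positivity)
            have : 0 ≤ 1 / Real.log V := by positivity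
            linarith
        _ = 24 * C / c ^ 4 := mul_one _
    calc (∫ t in (1:ℝ)..Real.exp 1, f t) + ∫ t in Real.exp 1..V, f t ≤ C + 24 * C / c ^ 4 :=
          add_le_add (hI1 _ he1 le_rfl) hI2
      _ = C * (1 + 24 / c ^ 4) := by ring

end FriableMoebiusRoot

end Literature.NumberTheory.Sieve
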